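import Literature.NumberTheory.LFunctions.SekatskiiLiArithmeticFormulaProofs
import Literature.Analysis.SpecialFunctions.LaguerreLaplaceTransform
import HarnessLib

/-!
# Sekatskii's Laguerre form of the derivatives `(1/(n−1)!) dⁿ/dzⁿ[(z+b)^{n−1} ln ζ(z)]` (Lemma 1)

LABEL (line 1): **RH-FREE** — identities only: the prime-power ("arithmetic") part of Sekatskii's
generalized Li derivatives is a Dirichlet series in the associated Laguerre polynomials
`L^{(1)}_{n−1}` (S. K. Sekatskii, arXiv:1404.7276v2, §2, **Lemma 1 / eqs. (9), (10), (6)**), PROVED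
here, together with the kernel dictionary to the tree's arithmetic formula for the generalized Li
sums `k_{n,a}` (`liSekatskiiArith`, `Sekatskii2014_thm7_holds`).  bears_on: LADDER-RH L-C/L-P
(COLUMN 4, LI; the `a`-family row; DATA.md §N.12 «the Laguerre bridge» for `b = 0`).  WHAT THIS IS
NOT: writing the prime sums of `k_{n,a}` with `L^{(1)}_{n−1}((2a−1) ln m)` is bookkeeping on the
side `Re z > 1` of absolute convergence; it re-expresses, it does not bound; nothing here bears on
the truth of RH.

Source.  S. K. Sekatskii, *First applications of generalized Li's criterion to study the Riemann
zeta-function zeroes location*, arXiv:1404.7276v2 (2015) [Sekatskii2015FirstApplications], §2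
(pp. 6–9 of the arXiv PDF; published form Springer PROMS **358** (2021) 241–254, not held,
`acq-11710`).  The tree's earlier files on this paper (`SekatskiiLargeShiftPositivity.lean`,
`SekatskiiLiSumsAsymptotic.lean`) could not read the displayed formulas of Lemma 1 off the held text;
they are typed here from a fresh decoding of the arXiv PDF (pypdf, with the private-use-area code
points of the embedded `SymbolMT` font mapped back through the Adobe Symbol encoding), which reads,
verbatim up to layout:

* **Lemma 1** (p. 8–9). "For `Re z > 1`,
  `(1/(n−1)!) dⁿ/dzⁿ((z+b)^{n−1} ln(ς(z))) = −Σ_{m=1}^{∞} Λ(m) m^{−z} L¹_{n−1}((b+z) ln m)` (9), where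
  `L¹_{n−1}(x) = … = Σ_j (−1)^j C^{j+1}_n x^j/j!` is generalized Laguerre polynomial."  Proof printed
  p. 8–9: Leibniz rule, `dⁿ((z+b)^{n−1})/dzⁿ = 0` (the `j = 0` term), `ς′(z)/ς(z) = −Σ Λ(m) m^{−z}`
  "valid for `Re z > 1` [4]", termwise differentiation, change of the summation order, "reminding the
  definition of Laguerre polynomials".
* **eq. (10)** (p. 9). "Evident consequence of the above Lemma is, for `b > 0`,
  `(1/(n−1)!) dⁿ/dzⁿ((z+b)^{n−1} ln(ς(z)))|_{z=b+1} = −Σ_{m=1}^{∞} (Λ(m)/m^{b+1}) L¹_{n−1}((2b+1) ln m)`."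
* **eq. (6)** (p. 7). `(1/(n−1)!) dⁿ/dzⁿ((z+b)^{n−1} ln(z−1))|_{z=b+1} = (1/(2b+1))(1 − (−1−1/b)ⁿ)`
  (there obtained from the generalized Littlewood theorem with `g̃(z) = n(2b+1)(z+b)^{n−1}/(z−b−1)^{n+1}`;
  here: Leibniz and the binomial theorem).

## Dictionary (paper ↦ tree)

* `ς` is the paper's glyph for `ζ`; `Λ` = `ArithmeticFunction.vonMangoldt`; `L¹_{n−1}` =
  `Literature.Analysis.SpecialFunctions.laguerre 1 (n − 1)` (Szegő's normalisation, `α = 1`;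
  coefficients `(−1)^j C(n, j+1)/j!` = `laguerreCoeff_one`), evaluated at complex points through
  `Polynomial.aeval`, at real points through `Polynomial.eval`.
* "`ln ς(z)`, `Re z > 1`": every holomorphic branch (the `n ≥ 1` derivatives of `(z+b)^{n−1}·const`
  vanish), so the identity is typed for ANY `F` with `F′ = ς′/ς = −Σ Λ(m)m^{−z}` near `z`
  (`sekatskii2015_lemma1_of_hasDerivAt`), and specialised to the Dirichlet series
  `Σ (Λ(m)/ln m) m^{−z}` (`= ln ς(z)`: `exp` of it is `ς(z)`, the tree's
  `exp_LSeries_vonMangoldt_div_log_eq_riemannZeta`) — `sekatskii2015_lemma1` — and to the principal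
  `Complex.log ∘ riemannZeta` near real points `σ > 1` (`sekatskii2015_lemma1_log`, eq. (10)).
* paper's `b` = `−a` of [Sekatskii2014] and of the tree's `k_{n,a} = liSekatskiiSum a n`; on the side
  `Re z > 1` the relevant tree parameter is `A = b + 1 > 1` (`2A − 1 = 2b + 1`).

## Contents (source item ↦ declaration; all PROVED, no definitions, no named facts)

* §1 `Sekatskii2015Laguerre.iteratedDeriv_sub_pow_mul_div_eq_sum` — Leibniz' rule in the form used
  throughout: `(1/(n−1)!) dⁿ[(z−a)^{n−1}F](p) = Σ_{j<n} C(n,j+1)(p−a)^j/j! · G^{(j)}(p)` whenever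
  `F′ = G` near `p` (generalises the tree's `Sekatskii2014Thm7.key_sum`).
* §2 **Lemma 1**: `sekatskii2015_lemma1_of_hasDerivAt` (any branch), `sekatskii2015_lemma1`
  (Dirichlet-series branch), `sekatskii2015_lemma1_log` (principal `log ζ` near a real `σ > 1`).
* §3 **eq. (10)** `sekatskii2015_eq10` (real form at `z = b+1`, `b > 0`); **eq. (6)** `sekatskii2015_eq6`;
  and their sum for `ς₁(z) = (z−1)ς(z)` (the tree's `riemannZeta₁`): `sekatskii2015_eq6_eq10`
  = the object differentiated in the paper's (7a)/Proposition 1 (sibling file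
  `SekatskiiLiZetaPartCriterion.lean`).
* §4 kernel dictionary: `Sekatskii2015Laguerre.primePart_eq_laguerre` (the prime part of
  `liSekatskiiArith A n` is `−(2A−1) Σ_m Λ(m) m^{−A} L¹_{n−1}((2A−1) ln m)`) and
  `liSekatskiiSum_eq_laguerre` (the arithmetic formula for `k_{n,A}`, `A > 1`, in Laguerre dress —
  the paper's (7) combined with (10)).

Deliberately NOT here: Theorem 4 (the "generalized Littlewood theorem", a contour-integration tool,
pp. 4–5) and the derivation (4)–(8a) of the closed/Gamma terms through it (the tree proves the same
closed terms by Leibniz: `Sekatskii2014_thm7_holds`); Remark 1.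

## References

* [Sekatskii2015FirstApplications] S. K. Sekatskii, arXiv:1404.7276v2 (2015), §2: Lemma 1,
  eqs. (6), (7), (9), (10) (pp. 6–9); Springer PROMS 358 (2021) 241–254.
* [Sekatskii2014] S. K. Sekatskii, Ukr. Math. J. 66 (2014) 415–431, Thm 7 eq. (10) (the arithmetic
  formula; tree: `Sekatskii2014_thm7_holds`).
* [Szego1975] G. Szegő, *Orthogonal Polynomials*, 4th ed. (1975), (5.1.6) (`L_n^{(α)}`).
-/

noncomputable section

open Complex Filter Topology Set LSeries Polynomial
open scoped Nat LSeries.notation ArithmeticFunction.vonMangoldt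

namespace Literature.NumberTheory.LFunctions

open Literature.Analysis.SpecialFunctions (laguerre laguerreCoeff laguerreCoeff_one eval_laguerre)
open Sekatskii2014Eq6 (iteratedDeriv_sub_pow_mul_eq_sum_at)

namespace Sekatskii2015Laguerre

/-! ### §1. Leibniz' rule for `(z − a)^{n−1} F(z)` in terms of `G = F′` -/

/-- **Leibniz' rule, reduced to `G = F′`**: if `F′ = G` on a neighbourhood of `p`, then for `n ≥ 1`
`(1/(n−1)!) dⁿ/dzⁿ[(z−a)^{n−1} F(z)]|_{z=p} = Σ_{j<n} C(n,j+1) (p−a)^j/j! · G^{(j)}(p)` (the term with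
`dⁿ(z−a)^{n−1}/dzⁿ = 0` drops out, "the term corresponding to `j=0` is clearly zero", p. 8).
[cite: Sekatskii2015FirstApplications, Lemma 1 (proof, p. 8)] -/
theorem iteratedDeriv_sub_pow_mul_div_eq_sum {F G : ℂ → ℂ} {p : ℂ} (a : ℂ) {n : ℕ} (hn : 1 ≤ n)
    (hF : ∀ᶠ z in 𝓝 p, HasDerivAt F (G z) z) :
    iteratedDeriv n (fun z ↦ (z - a) ^ (n - 1) * F z) p / ((n - 1)! : ℂ) =
      ∑ j ∈ Finset.range n, (n.choose (j + 1) : ℂ) * (p - a) ^ j / (j ! : ℂ) *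
        iteratedDeriv j G p := by
  have hFa : AnalyticAt ℂ F p :=
    Complex.analyticAt_iff_eventually_differentiableAt.2 (hF.mono fun z hz ↦ hz.differentiableAt)
  have hderiv : deriv F =ᶠ[𝓝 p] G := hF.mono fun z hz ↦ hz.deriv
  have hsucc : ∀ j : ℕ, iteratedDeriv (j + 1) F p = iteratedDeriv j G p := fun j ↦ by
    rw [iteratedDeriv_succ']
    exact hderiv.iteratedDeriv_eq j
  rw [iteratedDeriv_sub_pow_mul_eq_sum_at hn a p hFa.contDiffAt, Finset.sum_div,
    ← Finset.sum_range_reflect]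
  refine Finset.sum_congr rfl fun j hj ↦ ?_
  have hj' : j < n := Finset.mem_range.1 hj
  have e1 : n - (n - 1 - j) = j + 1 := by omega
  have e2 : n - 1 - (n - 1 - j) = j := by omega
  rw [e1, e2, Nat.choose_symm_of_eq_add (by omega : n = (n - 1 - j) + (j + 1)), hsucc]
  have key : (((n - 1).descFactorial (n - 1 - j) : ℕ) : ℂ) * (j ! : ℂ) = ((n - 1)! : ℂ) := by
    have h := Nat.factorial_mul_descFactorial (show n - 1 - j ≤ n - 1 by omega)
    rw [show n - 1 - (n - 1 - j) = j by omega, mul_comm] at h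
    exact_mod_cast h
  have hj0 : (j ! : ℂ) ≠ 0 := by exact_mod_cast (Nat.factorial_pos j).ne'
  have hn0 : ((n - 1)! : ℂ) ≠ 0 := by exact_mod_cast (Nat.factorial_pos _).ne'
  have hdesc : (((n - 1).descFactorial (n - 1 - j) : ℕ) : ℂ) = ((n - 1)! : ℂ) / (j ! : ℂ) := by
    rw [eq_div_iff hj0, key]
  rw [hdesc]
  field_simp

/-! ### The Laguerre polynomial `L^{(1)}_{n−1}` at a complex point -/

/-- `L_k^{(1)}(w) = Σ_{j ≤ k} (−1)^j C(k+1, j+1)/j! · w^j` at a complex point `w`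
(`laguerreCoeff_one`). [cite: Szego1975, (5.1.6)] -/
theorem aeval_laguerre_one (k : ℕ) (w : ℂ) :
    aeval w (laguerre 1 k) =
      ∑ j ∈ Finset.range (k + 1), (-1) ^ j * ((k + 1).choose (j + 1) : ℂ) / (j ! : ℂ) * w ^ j := by
  rw [laguerre, map_sum]
  refine Finset.sum_congr rfl fun j hj ↦ ?_
  have hjk : j ≤ k := Nat.lt_succ_iff.1 (Finset.mem_range.1 hj)
  rw [map_mul, map_pow, aeval_C, aeval_X, laguerreCoeff_one k j hjk, Complex.coe_algebraMap]
  push_cast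
  ring

/-- The same at a real point, as a real number. [cite: Szego1975, (5.1.6)] -/
theorem eval_laguerre_one (k : ℕ) (x : ℝ) :
    (laguerre 1 k).eval x =
      ∑ j ∈ Finset.range (k + 1), (-1) ^ j * ((k + 1).choose (j + 1) : ℝ) / (j ! : ℝ) * x ^ j := by
  rw [eval_laguerre]
  refine Finset.sum_congr rfl fun j hj ↦ ?_
  rw [laguerreCoeff_one k j (Nat.lt_succ_iff.1 (Finset.mem_range.1 hj))]

/-- `aeval` at a real point is the real evaluation of `L_k^{(1)}`. [cite: Szego1975, (5.1.6)] -/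
theorem aeval_laguerre_one_ofReal (k : ℕ) (x : ℝ) :
    aeval (x : ℂ) (laguerre 1 k) = (((laguerre 1 k).eval x : ℝ) : ℂ) := by
  rw [aeval_laguerre_one, eval_laguerre_one]
  push_cast
  rfl

/-! ### The Dirichlet series `ln ζ(z) = Σ (Λ(m)/ln m) m^{−z}` and `ζ′/ζ = −Σ Λ(m) m^{−z}` -/

/-- `|Λ(m)/ln m| ≤ 1`. [folklore] -/
private theorem norm_vonMangoldt_div_log_le (m : ℕ) : ‖((Λ m / Real.log m : ℝ) : ℂ)‖ ≤ 1 := by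
  rw [Complex.norm_real, Real.norm_eq_abs]
  rcases eq_or_ne (Real.log m) 0 with h0 | h0
  · rw [h0, div_zero, abs_zero]; exact zero_le_one
  · rw [abs_div, div_le_one (abs_pos.mpr h0), abs_of_nonneg ArithmeticFunction.vonMangoldt_nonneg,
      abs_of_nonneg (Real.log_natCast_nonneg m)]
    exact ArithmeticFunction.vonMangoldt_le_log

/-- The abscissa of absolute convergence of `Σ (Λ(m)/ln m) m^{−z}` is `≤ 1`. [folklore] -/
private theorem abscissaOfAbsConv_vonMangoldt_div_log_le :
    abscissaOfAbsConv (fun m ↦ ((Λ m / Real.log m : ℝ) : ℂ)) ≤ 1 :=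
  abscissaOfAbsConv_le_of_forall_lt_LSeriesSummable fun _ hy ↦
    LSeriesSummable_of_bounded_of_one_lt_real (fun m _ ↦ norm_vonMangoldt_div_log_le m) hy

/-- The abscissa of absolute convergence of `Σ Λ(m) m^{−z}` is `≤ 1`. [folklore] -/
private theorem abscissaOfAbsConv_vonMangoldt_le : abscissaOfAbsConv ↗Λ ≤ 1 :=
  abscissaOfAbsConv_le_of_forall_lt_LSeriesSummable fun y hy ↦
    ArithmeticFunction.LSeriesSummable_vonMangoldt (by simpa using hy)

/-- `ln m · (Λ(m)/ln m) = Λ(m)` for every `m` (both sides vanish at `m = 0, 1`). [folklore] -/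
private theorem logMul_vonMangoldt_div_log : logMul (fun m ↦ ((Λ m / Real.log m : ℝ) : ℂ)) = ↗Λ := by
  funext m
  change Complex.log m * ((Λ m / Real.log m : ℝ) : ℂ) = (Λ m : ℂ)
  rcases eq_or_ne (Real.log m) 0 with h0 | h0
  · have hm : m = 0 ∨ m = 1 := by
      rcases Nat.lt_or_ge m 2 with h | h
      · omega
      · exfalso
        have : (0 : ℝ) < Real.log m := Real.log_pos (by exact_mod_cast h)
        linarith
    rcases hm with rfl | rfl <;> simp [ArithmeticFunction.vonMangoldt_apply_one]
  · have h0' : Complex.log (m : ℂ) ≠ 0 := by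
      rw [← Complex.natCast_log]; exact Complex.ofReal_ne_zero.2 h0
    rw [Complex.ofReal_div, Complex.natCast_log]
    field_simp

/-- **`(ln ζ)′ = ζ′/ζ = −Σ Λ(m) m^{−z}` on `Re z > 1`**, for the Dirichlet series
`ln ζ(z) = Σ (Λ(m)/ln m) m^{−z}` ("Using `ς′(z)/ς(z) = −Σ Λ(m)/m^z` valid for `Re z > 1` [4]", p. 9).
[cite: Sekatskii2015FirstApplications, Lemma 1 (proof, p. 9)] -/
theorem hasDerivAt_LSeries_vonMangoldt_div_log {z : ℂ} (hz : 1 < z.re) :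
    HasDerivAt (L (fun m ↦ ((Λ m / Real.log m : ℝ) : ℂ))) (-L ↗Λ z) z := by
  have h : abscissaOfAbsConv (fun m ↦ ((Λ m / Real.log m : ℝ) : ℂ)) < z.re :=
    lt_of_le_of_lt abscissaOfAbsConv_vonMangoldt_div_log_le (by exact_mod_cast hz)
  have := LSeries_hasDerivAt h
  rwa [logMul_vonMangoldt_div_log] at this

/-- Near a real point `σ > 1` the principal `log ζ` is holomorphic with derivative
`ζ′/ζ = −Σ Λ(m) m^{−z}` (`ζ(σ) > 0`, so `ζ` stays in the slit plane nearby) — the printed step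
"Using `ς′(z)/ς(z) = −Σ Λ(m)/m^z` valid for `Re z > 1` [4]" for the principal branch.
[cite: Sekatskii2015FirstApplications, Lemma 1 (proof, p. 9)] -/
theorem eventually_hasDerivAt_log_riemannZeta {σ : ℝ} (hσ : 1 < σ) :
    ∀ᶠ z in 𝓝 (σ : ℂ), HasDerivAt (fun s ↦ Complex.log (riemannZeta s)) (-L ↗Λ z) z := by
  have hopen : IsOpen {z : ℂ | 1 < z.re} := isOpen_lt continuous_const Complex.continuous_re
  have hσ' : (σ : ℂ) ∈ {z : ℂ | 1 < z.re} := by simpa using hσ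
  have hslit : riemannZeta σ ∈ slitPlane :=
    mem_slitPlane_iff.2 (Or.inl (riemannZeta_re_pos_of_one_lt hσ))
  have hcont : ContinuousAt riemannZeta (σ : ℂ) :=
    (differentiableAt_riemannZeta (by
      intro h; have := congrArg Complex.re h; simp at this; linarith)).continuousAt
  filter_upwards [hopen.mem_nhds hσ', hcont.eventually_mem (isOpen_slitPlane.mem_nhds hslit)]
    with z hz hzs
  have hz1 : z ≠ 1 := by intro h; rw [h] at hz; simp at hz
  have hd := (differentiableAt_riemannZeta hz1).hasDerivAt.clog hzs
  rw [ArithmeticFunction.LSeries_vonMangoldt_eq_deriv_riemannZeta_div hz, neg_div, neg_neg]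
  exact hd

/-! ### The terms `Λ(m) lnʲ m / m^z` -/

/-- `logʲ·Λ`, iterated: `logMul^[j] Λ m = (log m)^j Λ(m)`. [folklore] -/
private theorem logMul_iterate_vonMangoldt_apply (j m : ℕ) :
    (logMul^[j] ↗Λ) m = (Complex.log m) ^ j * (Λ m : ℂ) := by
  induction j with
  | zero => simp
  | succ j ih =>
    rw [Function.iterate_succ_apply']
    change Complex.log m * (logMul^[j] ↗Λ) m = _
    rw [ih, pow_succ]
    ring

/-- The terms of `Σ Λ(m) lnʲm · m^{−z}`: `term (logʲΛ) z m = Λ(m) (ln m)ʲ / m^z` (also at `m = 0`,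
where both sides are `0`). [folklore] -/
private theorem term_logMul_iterate_vonMangoldt (j : ℕ) (z : ℂ) (m : ℕ) :
    term (logMul^[j] ↗Λ) z m = (Λ m : ℂ) * ((Real.log m : ℂ)) ^ j / (m : ℂ) ^ z := by
  rcases Nat.eq_zero_or_pos m with rfl | hm
  · simp [term_zero]
  · rw [term_of_ne_zero hm.ne', logMul_iterate_vonMangoldt_apply, Complex.natCast_log]
    ring

/-- Summability of `Σ_m Λ(m) lnʲ m / m^z` for `Re z > 1`. [folklore] -/
private theorem summable_vonMangoldt_mul_log_pow_div {z : ℂ} (hz : 1 < z.re) (j : ℕ) :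
    Summable fun m : ℕ ↦ (Λ m : ℂ) * ((Real.log m : ℂ)) ^ j / (m : ℂ) ^ z := by
  have h : abscissaOfAbsConv (logMul^[j] ↗Λ) < z.re := by
    rw [absicssaOfAbsConv_logPowMul]
    exact lt_of_le_of_lt abscissaOfAbsConv_vonMangoldt_le (by exact_mod_cast hz)
  have hs : LSeriesSummable (logMul^[j] ↗Λ) z := LSeriesSummable_of_abscissaOfAbsConv_lt_re h
  exact hs.congr fun m ↦ term_logMul_iterate_vonMangoldt j z m

/-- `dʲ/dzʲ(−Σ Λ(m) m^{−z}) = (−1)^{j+1} Σ Λ(m) lnʲm · m^{−z}` for `Re z > 1` (termwise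
differentiation, Mathlib's `LSeries_iteratedDeriv`). [cite: Sekatskii2015FirstApplications, Lemma 1 (proof, p. 8–9)] -/
theorem iteratedDeriv_neg_LSeries_vonMangoldt {z : ℂ} (hz : 1 < z.re) (j : ℕ) :
    iteratedDeriv j (fun s ↦ -L ↗Λ s) z =
      (-1) ^ (j + 1) * ∑' m : ℕ, (Λ m : ℂ) * ((Real.log m : ℂ)) ^ j / (m : ℂ) ^ z := by
  have h : abscissaOfAbsConv ↗Λ < z.re :=
    lt_of_le_of_lt abscissaOfAbsConv_vonMangoldt_le (by exact_mod_cast hz)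
  rw [iteratedDeriv_fun_neg, LSeries_iteratedDeriv j h, LSeries]
  simp_rw [term_logMul_iterate_vonMangoldt j z]
  ring

end Sekatskii2015Laguerre

open Sekatskii2015Laguerre

/-! ### §2. Lemma 1 -/

/-- **Sekatskii 2015, Lemma 1 (eq. (9)) — for an arbitrary branch of `ln ζ`**: if `F` is
holomorphic near `z`, `Re z > 1`, with `F′ = ζ′/ζ = −Σ Λ(m) m^{−s}` there, then for every `n ≥ 1`
and every (complex) `b`,
`(1/(n−1)!) dⁿ/dzⁿ[(z+b)^{n−1} F(z)] = −Σ_{m≥1} Λ(m) m^{−z} L^{(1)}_{n−1}((b+z) ln m)`.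
Printed for "`ln ς(z)`" and real `b`; the branch and the reality of `b` play no role (PROVED by the
printed argument: Leibniz, termwise differentiation of `−Σ Λ(m)m^{−s}`, exchange of the finite and
the absolutely convergent sum, and the explicit coefficients `(−1)^j C(n,j+1)/j!` of `L^{(1)}_{n−1}`).
[cite: Sekatskii2015FirstApplications, Lemma 1, eq. (9) (pp. 8–9)] -/
theorem sekatskii2015_lemma1_of_hasDerivAt {F : ℂ → ℂ} {z : ℂ} (b : ℂ) {n : ℕ} (hn : 1 ≤ n)
    (hz : 1 < z.re) (hF : ∀ᶠ s in 𝓝 z, HasDerivAt F (-L ↗Λ s) s) :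
    iteratedDeriv n (fun s ↦ (s + b) ^ (n - 1) * F s) z / ((n - 1)! : ℂ) =
      -∑' m : ℕ, (Λ m : ℂ) / (m : ℂ) ^ z * aeval ((b + z) * Real.log m) (laguerre 1 (n - 1)) := by
  obtain ⟨k, rfl⟩ : ∃ k, n = k + 1 := ⟨n - 1, by omega⟩
  have hfun : (fun s ↦ (s + b) ^ (k + 1 - 1) * F s) = fun s ↦ (s - (-b)) ^ (k + 1 - 1) * F s := by
    funext s; rw [sub_neg_eq_add]
  rw [hfun, iteratedDeriv_sub_pow_mul_div_eq_sum (-b) hn hF]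
  simp only [sub_neg_eq_add, Nat.add_sub_cancel]
  -- substitute the derivatives of `−Σ Λ m^{−s}` and expand the Laguerre polynomial
  have hS := summable_vonMangoldt_mul_log_pow_div hz
  simp_rw [iteratedDeriv_neg_LSeries_vonMangoldt hz, aeval_laguerre_one]
  -- exchange the sums
  have hswap : ∑' m : ℕ, (Λ m : ℂ) / (m : ℂ) ^ z *
      ∑ j ∈ Finset.range (k + 1), (-1) ^ j * ((k + 1).choose (j + 1) : ℂ) / (j ! : ℂ) *
        ((b + z) * Real.log m) ^ j =
      ∑ j ∈ Finset.range (k + 1), ∑' m : ℕ, (Λ m : ℂ) / (m : ℂ) ^ z *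
        ((-1) ^ j * ((k + 1).choose (j + 1) : ℂ) / (j ! : ℂ) * ((b + z) * Real.log m) ^ j) := by
    simp_rw [Finset.mul_sum]
    refine Summable.tsum_finsetSum fun j _ ↦ ?_
    have := (hS j).mul_left ((-1) ^ j * ((k + 1).choose (j + 1) : ℂ) / (j ! : ℂ) * (b + z) ^ j)
    refine this.congr fun m ↦ ?_
    rw [mul_pow]
    ring
  rw [hswap, ← Finset.sum_neg_distrib]
  refine Finset.sum_congr rfl fun j _ ↦ ?_
  rw [← tsum_mul_left, ← tsum_mul_left, ← tsum_neg]
  refine tsum_congr fun m ↦ ?_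
  rw [mul_pow]
  ring

/-- **Sekatskii 2015, Lemma 1 (eq. (9))**: "For `Re z > 1`,
`(1/(n−1)!) dⁿ/dzⁿ((z+b)^{n−1} ln ς(z)) = −Σ_{m=1}^{∞} Λ(m) m^{−z} L¹_{n−1}((b+z) ln m)`", with
`ln ς(z)` the Dirichlet series `Σ (Λ(m)/ln m) m^{−z}` (the holomorphic logarithm of `ζ` on `Re z > 1`
that is real on the real axis; `exp` of it is `ζ(z)` — tree: `exp_LSeries_vonMangoldt_div_log_eq_riemannZeta`),
`n ≥ 1`, `b` arbitrary. [cite: Sekatskii2015FirstApplications, Lemma 1, eq. (9) (pp. 8–9)] -/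
theorem sekatskii2015_lemma1 {z : ℂ} (b : ℂ) {n : ℕ} (hn : 1 ≤ n) (hz : 1 < z.re) :
    iteratedDeriv n (fun s ↦ (s + b) ^ (n - 1) * L (fun m ↦ ((Λ m / Real.log m : ℝ) : ℂ)) s) z /
        ((n - 1)! : ℂ) =
      -∑' m : ℕ, (Λ m : ℂ) / (m : ℂ) ^ z * aeval ((b + z) * Real.log m) (laguerre 1 (n - 1)) := by
  refine sekatskii2015_lemma1_of_hasDerivAt b hn hz ?_
  have hopen : IsOpen {s : ℂ | 1 < s.re} := isOpen_lt continuous_const Complex.continuous_re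
  filter_upwards [hopen.mem_nhds (by simpa using hz)] with s hs
  exact hasDerivAt_LSeries_vonMangoldt_div_log hs

/-- **Lemma 1 for the principal logarithm near a real point**: for real `σ > 1` (where `ζ(σ) > 0`
and `Complex.log ∘ ζ` is holomorphic nearby), `n ≥ 1`, any `b`,
`(1/(n−1)!) dⁿ/dzⁿ[(z+b)^{n−1} log ζ(z)]|_{z=σ} = −Σ_m Λ(m) m^{−σ} L¹_{n−1}((b+σ) ln m)`.
[cite: Sekatskii2015FirstApplications, Lemma 1, eq. (9) (pp. 8–9)] -/
theorem sekatskii2015_lemma1_log {σ : ℝ} (hσ : 1 < σ) (b : ℂ) {n : ℕ} (hn : 1 ≤ n) :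
    iteratedDeriv n (fun s ↦ (s + b) ^ (n - 1) * Complex.log (riemannZeta s)) σ / ((n - 1)! : ℂ) =
      -∑' m : ℕ, (Λ m : ℂ) / (m : ℂ) ^ (σ : ℂ) * aeval ((b + σ) * Real.log m) (laguerre 1 (n - 1)) :=
  sekatskii2015_lemma1_of_hasDerivAt b hn (by simpa using hσ) (eventually_hasDerivAt_log_riemannZeta hσ)

/-! ### §3. Eq. (10), eq. (6), and their sum for `ζ₁(z) = (z − 1)ζ(z)` -/

namespace Sekatskii2015Laguerre

/-- The terms of (10) are real: `Λ(m) m^{−σ} L¹_{k}(x ln m)` with real `σ, x`. [folklore] -/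
private theorem term_eq10_ofReal (σ x : ℝ) (k m : ℕ) :
    (Λ m : ℂ) / (m : ℂ) ^ (σ : ℂ) * aeval (((x : ℝ) : ℂ) * Real.log m) (laguerre 1 k) =
      (((Λ m : ℝ) / (m : ℝ) ^ σ * (laguerre 1 k).eval (x * Real.log m) : ℝ) : ℂ) := by
  have hm0 : (0 : ℝ) ≤ m := Nat.cast_nonneg m
  rw [show ((x : ℝ) : ℂ) * (Real.log m : ℂ) = ((x * Real.log m : ℝ) : ℂ) by push_cast; ring,
    aeval_laguerre_one_ofReal, show (m : ℂ) = ((m : ℝ) : ℂ) by norm_cast,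
    ← Complex.ofReal_cpow hm0]
  push_cast
  ring

end Sekatskii2015Laguerre

/-- **Sekatskii 2015, eq. (10)**: "Evident consequence of the above Lemma is, for `b > 0`,
`(1/(n−1)!) dⁿ/dzⁿ((z+b)^{n−1} ln(ς(z)))|_{z=b+1} = −Σ_{m=1}^{∞} (Λ(m)/m^{b+1}) L¹_{n−1}((2b+1) ln m)`"
(`n ≥ 1`; principal `log ζ` near the real point `b + 1 > 1`, the value being real).
[cite: Sekatskii2015FirstApplications, eq. (10) (p. 9)] -/
theorem sekatskii2015_eq10 {b : ℝ} (hb : 0 < b) {n : ℕ} (hn : 1 ≤ n) :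
    iteratedDeriv n (fun s ↦ (s + b) ^ (n - 1) * Complex.log (riemannZeta s)) ((b + 1 : ℝ) : ℂ) /
        ((n - 1)! : ℂ) =
      -((∑' m : ℕ, (Λ m : ℝ) / (m : ℝ) ^ (b + 1) *
          (laguerre 1 (n - 1)).eval ((2 * b + 1) * Real.log m) : ℝ) : ℂ) := by
  rw [sekatskii2015_lemma1_log (by linarith) (b : ℂ) hn, Complex.ofReal_tsum]
  congr 1
  refine tsum_congr fun m ↦ ?_
  rw [show (b : ℂ) + ((b + 1 : ℝ) : ℂ) = (((2 * b + 1 : ℝ)) : ℂ) by push_cast; ring]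
  exact term_eq10_ofReal (b + 1) (2 * b + 1) (n - 1) m

namespace Sekatskii2015Laguerre

/-- `ζ₁(σ) = (σ−1)ζ(σ)` has positive real part at a real `σ > 1`. [folklore] -/
private theorem riemannZeta₁_ofReal_re_pos' {σ : ℝ} (hσ : 1 < σ) : 0 < (riemannZeta₁ σ).re := by
  have h1 : (σ : ℂ) ≠ 1 := by
    intro h; have := congrArg Complex.re h; simp at this; linarith
  have hz := (Complex.pos_iff.mp (riemannZeta_pos_of_one_lt hσ)).1
  rw [riemannZeta₁_eq_mul h1, show (σ : ℂ) - 1 = ((σ - 1 : ℝ) : ℂ) by push_cast; ring,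
    Complex.re_ofReal_mul]
  exact mul_pos (by linarith) hz

/-- `dʲ/dsʲ (s − d)⁻¹ |_{s=c} = (−1)ʲ j! (c − d)^{−(j+1)}` (Mathlib's `iter_deriv_inv_linear_sub`).
[folklore] -/
private theorem iteratedDeriv_inv_sub (j : ℕ) (d c : ℂ) :
    iteratedDeriv j (fun s : ℂ ↦ (s - d)⁻¹) c = (-1) ^ j * j ! * ((c - d)⁻¹) ^ (j + 1) := by
  have hf : (fun s : ℂ ↦ (s - d)⁻¹) = fun s ↦ (1 * s - d)⁻¹ := by funext s; rw [one_mul]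
  rw [hf, iteratedDeriv_eq_iterate, iter_deriv_inv_linear_sub j 1 d]
  simp only [one_pow, mul_one, one_mul]
  have ez : ∀ w : ℂ, w ^ (-1 - j : ℤ) = (w⁻¹) ^ (j + 1) := by
    intro w
    rw [show (-1 - j : ℤ) = -((j + 1 : ℕ) : ℤ) by push_cast; ring, zpow_neg, zpow_natCast, inv_pow]
  rw [ez]

/-- The binomial sum behind eq. (6): for `b ≠ 0`,
`Σ_{j<n} C(n,j+1)(2b+1)^j/j! · (−1)^j j! b^{−(j+1)} = (1 − (−1 − 1/b)ⁿ)/(2b+1)` (when `2b+1 ≠ 0`).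
[cite: Sekatskii2015FirstApplications, eq. (6) (p. 7)] -/
theorem sum_choose_mul_inv_pow {b : ℂ} (hb : b ≠ 0) (hb2 : 2 * b + 1 ≠ 0) (n : ℕ) :
    ∑ j ∈ Finset.range n, (n.choose (j + 1) : ℂ) * (2 * b + 1) ^ j / (j ! : ℂ) *
        ((-1) ^ j * j ! * (b⁻¹) ^ (j + 1)) =
      (1 - (-1 - 1 / b) ^ n) / (2 * b + 1) := by
  have hterm : ∀ j ∈ Finset.range n,
      (n.choose (j + 1) : ℂ) * (2 * b + 1) ^ j / (j ! : ℂ) * ((-1) ^ j * j ! * (b⁻¹) ^ (j + 1)) =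
        (2 * b + 1)⁻¹ * ((n.choose (j + 1) : ℂ) * ((-1) ^ j * ((2 * b + 1) / b) ^ (j + 1))) := by
    intro j _
    have hj0 : (j ! : ℂ) ≠ 0 := by exact_mod_cast (Nat.factorial_pos j).ne'
    rw [div_pow, inv_pow]
    field_simp
    ring
  rw [Finset.sum_congr rfl hterm, ← Finset.mul_sum, sum_range_choose_succ_mul_neg_pow]
  have e : (1 : ℂ) - (2 * b + 1) / b = -1 - 1 / b := by field_simp; ring
  rw [e]
  field_simp

end Sekatskii2015Laguerre

/-- **Sekatskii 2015, eq. (6)**: for `b > 0`, `n ≥ 1`,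
`(1/(n−1)!) dⁿ/dzⁿ((z+b)^{n−1} ln(z−1))|_{z=b+1} = (1/(2b+1))(1 − (−1 − 1/b)ⁿ)` (principal
`log (z − 1)` near `z = b + 1`, where `z − 1 = b > 0`).  Printed as an application of the
generalized Littlewood theorem; proved here by Leibniz and the binomial theorem.
[cite: Sekatskii2015FirstApplications, eq. (6) (p. 7)] -/
theorem sekatskii2015_eq6 {b : ℝ} (hb : 0 < b) {n : ℕ} (hn : 1 ≤ n) :
    iteratedDeriv n (fun s ↦ (s + b) ^ (n - 1) * Complex.log (s - 1)) ((b + 1 : ℝ) : ℂ) /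
        ((n - 1)! : ℂ) =
      (1 - (-1 - 1 / (b : ℂ)) ^ n) / (2 * b + 1) := by
  have hb0 : (b : ℂ) ≠ 0 := Complex.ofReal_ne_zero.2 hb.ne'
  have hb2 : 2 * (b : ℂ) + 1 ≠ 0 := by
    rw [show (2 : ℂ) * b + 1 = ((2 * b + 1 : ℝ) : ℂ) by push_cast; ring]
    exact Complex.ofReal_ne_zero.2 (by linarith)
  -- `log (s − 1)` has derivative `(s − 1)⁻¹` near `b + 1`
  have hF : ∀ᶠ s in 𝓝 ((b + 1 : ℝ) : ℂ), HasDerivAt (fun s ↦ Complex.log (s - 1)) ((s - 1)⁻¹) s := by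
    have hslit : ((b + 1 : ℝ) : ℂ) - 1 ∈ slitPlane := by
      rw [show ((b + 1 : ℝ) : ℂ) - 1 = ((b : ℝ) : ℂ) by push_cast; ring]
      exact Complex.ofReal_mem_slitPlane.2 hb
    have hcont : ContinuousAt (fun s : ℂ ↦ s - 1) ((b + 1 : ℝ) : ℂ) :=
      (continuous_id.sub continuous_const).continuousAt
    filter_upwards [hcont.eventually_mem (isOpen_slitPlane.mem_nhds hslit)] with s hs
    have h := ((hasDerivAt_id s).sub_const (1 : ℂ)).clog hs
    simpa using h
  have hfun : (fun s ↦ (s + (b : ℂ)) ^ (n - 1) * Complex.log (s - 1)) =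
      fun s ↦ (s - (-(b : ℂ))) ^ (n - 1) * Complex.log (s - 1) := by
    funext s; rw [sub_neg_eq_add]
  rw [hfun, iteratedDeriv_sub_pow_mul_div_eq_sum (-(b : ℂ)) hn hF]
  simp_rw [iteratedDeriv_inv_sub]
  have ep : ((b + 1 : ℝ) : ℂ) - -(b : ℂ) = 2 * b + 1 := by push_cast; ring
  have ep' : ((b + 1 : ℝ) : ℂ) - 1 = b := by push_cast; ring
  simp_rw [ep, ep']
  exact Sekatskii2015Laguerre.sum_choose_mul_inv_pow hb0 hb2 n

/-- **Eqs. (6) + (10) for `ζ₁(z) = (z−1)ζ(z)`** (the tree's `riemannZeta₁`; this is the object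
differentiated in the paper's (7a) and Proposition 1, "the expression to be differentiated does not
contain neither a pole nor a zero at `z=1`", p. 18): for `b > 0`, `n ≥ 1`,
`(1/(n−1)!) dⁿ/dzⁿ[(z+b)^{n−1} log((z−1)ζ(z))]|_{z=b+1}
   = (1 − (−1−1/b)ⁿ)/(2b+1) − Σ_m Λ(m) m^{−b−1} L¹_{n−1}((2b+1) ln m)`.
Proof: `ζ₁′/ζ₁ = 1/(z−1) − Σ Λ(m)m^{−z}` on `Re z > 1` (tree: `logDeriv_riemannZeta₁_eq_of_one_lt_re`),
Leibniz, and the two evaluations above. [cite: Sekatskii2015FirstApplications, eqs. (6), (10), (7a) (pp. 7, 9, 18)] -/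
theorem sekatskii2015_eq6_eq10 {b : ℝ} (hb : 0 < b) {n : ℕ} (hn : 1 ≤ n) :
    iteratedDeriv n (fun s ↦ (s + b) ^ (n - 1) * Complex.log (riemannZeta₁ s)) ((b + 1 : ℝ) : ℂ) /
        ((n - 1)! : ℂ) =
      (1 - (-1 - 1 / (b : ℂ)) ^ n) / (2 * b + 1) -
        ((∑' m : ℕ, (Λ m : ℝ) / (m : ℝ) ^ (b + 1) *
          (laguerre 1 (n - 1)).eval ((2 * b + 1) * Real.log m) : ℝ) : ℂ) := by
  have hp1 : 1 < (((b + 1 : ℝ) : ℂ)).re := by simp; linarith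
  have hb0 : (b : ℂ) ≠ 0 := Complex.ofReal_ne_zero.2 hb.ne'
  have hb2 : 2 * (b : ℂ) + 1 ≠ 0 := by
    rw [show (2 : ℂ) * b + 1 = ((2 * b + 1 : ℝ) : ℂ) by push_cast; ring]
    exact Complex.ofReal_ne_zero.2 (by linarith)
  have hopen : IsOpen {z : ℂ | 1 < z.re} := isOpen_lt continuous_const Complex.continuous_re
  -- `log ζ₁` is holomorphic near `p` with derivative `ζ₁′/ζ₁ = (z−1)⁻¹ − Σ Λ m^{−z}`
  have hF : ∀ᶠ s in 𝓝 ((b + 1 : ℝ) : ℂ), HasDerivAt (fun s ↦ Complex.log (riemannZeta₁ s))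
      ((s - 1)⁻¹ + -L ↗Λ s) s := by
    have hslit : riemannZeta₁ ((b + 1 : ℝ) : ℂ) ∈ slitPlane :=
      mem_slitPlane_iff.2 (Or.inl (riemannZeta₁_ofReal_re_pos' (by linarith)))
    have hcont : ContinuousAt riemannZeta₁ ((b + 1 : ℝ) : ℂ) :=
      (differentiable_riemannZeta₁ _).continuousAt
    filter_upwards [hopen.mem_nhds (show ((b + 1 : ℝ) : ℂ) ∈ {z : ℂ | 1 < z.re} from hp1),
      hcont.eventually_mem (isOpen_slitPlane.mem_nhds hslit)] with s hs hss
    have hd := (differentiable_riemannZeta₁ s).hasDerivAt.clog hss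
    have heq : deriv riemannZeta₁ s / riemannZeta₁ s = (s - 1)⁻¹ + -L ↗Λ s := by
      rw [← logDeriv_apply, logDeriv_riemannZeta₁_eq_of_one_lt_re hs, one_div, sub_eq_add_neg]
    rwa [heq] at hd
  have hfun : (fun s ↦ (s + (b : ℂ)) ^ (n - 1) * Complex.log (riemannZeta₁ s)) =
      fun s ↦ (s - (-(b : ℂ))) ^ (n - 1) * Complex.log (riemannZeta₁ s) := by
    funext s; rw [sub_neg_eq_add]
  rw [hfun, iteratedDeriv_sub_pow_mul_div_eq_sum (-(b : ℂ)) hn hF]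
  -- split the derivatives of the sum
  have hp1' : ((b + 1 : ℝ) : ℂ) ≠ 1 := by intro h; rw [h] at hp1; simp at hp1
  have hsplit : ∀ j ∈ Finset.range n,
      (n.choose (j + 1) : ℂ) * (((b + 1 : ℝ) : ℂ) - -(b : ℂ)) ^ j / (j ! : ℂ) *
          iteratedDeriv j (fun s ↦ (s - 1)⁻¹ + -L ↗Λ s) ((b + 1 : ℝ) : ℂ) =
        (n.choose (j + 1) : ℂ) * (2 * b + 1) ^ j / (j ! : ℂ) *
            ((-1) ^ j * j ! * ((b : ℂ)⁻¹) ^ (j + 1)) +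
          (n.choose (j + 1) : ℂ) * (((b + 1 : ℝ) : ℂ) - -(b : ℂ)) ^ j / (j ! : ℂ) *
            iteratedDeriv j (fun s ↦ -L ↗Λ s) ((b + 1 : ℝ) : ℂ) := by
    intro j _
    have h1 : ContDiffAt ℂ j (fun s : ℂ ↦ (s - 1)⁻¹) ((b + 1 : ℝ) : ℂ) :=
      ContDiffAt.inv (by fun_prop) (sub_ne_zero.2 hp1')
    have habs : abscissaOfAbsConv ↗Λ < (((b + 1 : ℝ) : ℂ)).re :=
      lt_of_le_of_lt abscissaOfAbsConv_vonMangoldt_le (by exact_mod_cast hp1)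
    have h2 : ContDiffAt ℂ j (fun s ↦ -L ↗Λ s) ((b + 1 : ℝ) : ℂ) :=
      ((LSeries_analyticOnNhd ↗Λ _ habs).contDiffAt).neg
    rw [iteratedDeriv_fun_add h1 h2, iteratedDeriv_inv_sub,
      show ((b + 1 : ℝ) : ℂ) - 1 = b by push_cast; ring]
    have e : ((b + 1 : ℝ) : ℂ) - -(b : ℂ) = 2 * b + 1 := by push_cast; ring
    rw [e]
    ring
  rw [Finset.sum_congr rfl hsplit, Finset.sum_add_distrib,
    Sekatskii2015Laguerre.sum_choose_mul_inv_pow hb0 hb2 n,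
    ← iteratedDeriv_sub_pow_mul_div_eq_sum (-(b : ℂ)) hn (eventually_hasDerivAt_log_riemannZeta
      (σ := b + 1) (by linarith))]
  have hfun' : (fun s ↦ (s - -(b : ℂ)) ^ (n - 1) * Complex.log (riemannZeta s)) =
      fun s ↦ (s + (b : ℂ)) ^ (n - 1) * Complex.log (riemannZeta s) := by
    funext s; rw [sub_neg_eq_add]
  rw [hfun', sekatskii2015_eq10 hb hn]
  ring

/-! ### §4. Kernel dictionary: the arithmetic formula for `k_{n,A}` in Laguerre dress -/

namespace Sekatskii2015Laguerre

/-- The real series `Σ_m Λ(m) lnʲ m / m^A` (`A > 1`) is summable. [folklore] -/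
private theorem summable_vonMangoldt_mul_log_pow_div_real {A : ℝ} (hA : 1 < A) (j : ℕ) :
    Summable fun m : ℕ ↦ (Λ m : ℝ) * Real.log m ^ j / (m : ℝ) ^ A := by
  have h := (summable_vonMangoldt_mul_log_pow_div (z := (A : ℂ)) (by simpa using hA) j)
  have h' := (Complex.hasSum_re h.hasSum).summable
  refine h'.congr fun m ↦ ?_
  have hm0 : (0 : ℝ) ≤ m := Nat.cast_nonneg m
  rw [show (m : ℂ) = ((m : ℝ) : ℂ) by norm_cast, ← Complex.ofReal_cpow hm0]
  rw [show (Λ m : ℂ) * ((Real.log m : ℂ)) ^ j / (((m : ℝ) ^ A : ℝ) : ℂ) =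
    (((Λ m : ℝ) * Real.log m ^ j / (m : ℝ) ^ A : ℝ) : ℂ) by push_cast; ring, Complex.ofReal_re]

/-- **The prime part of the tree's arithmetic formula in Laguerre form**: for `A > 1`, `n ≥ 1`,
`Σ_{j=1}^{n} C(n,j)(2A−1)^j((−1)^j/(j−1)!) Σ_m Λ(m)ln^{j−1}m/m^A = −(2A−1) Σ_m Λ(m) m^{−A} L¹_{n−1}((2A−1) ln m)`
(exchange of the finite and the absolutely convergent sums, and the coefficients of `L¹_{n−1}`);
with `A = b+1` this is `(2b+1)`·(eq. (10)). [cite: Sekatskii2015FirstApplications, eqs. (7), (10) (pp. 7, 9)] -/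
theorem primePart_eq_laguerre {A : ℝ} (hA : 1 < A) {n : ℕ} (hn : 1 ≤ n) :
    ∑ j ∈ Finset.Icc 1 n, (n.choose j : ℝ) * (2 * A - 1) ^ j * ((-1) ^ j / ((j - 1)! : ℝ)) *
        ∑' m : ℕ, (Λ m : ℝ) * Real.log m ^ (j - 1) / (m : ℝ) ^ A =
      -(2 * A - 1) * ∑' m : ℕ, (Λ m : ℝ) / (m : ℝ) ^ A *
        (laguerre 1 (n - 1)).eval ((2 * A - 1) * Real.log m) := by
  obtain ⟨k, rfl⟩ : ∃ k, n = k + 1 := ⟨n - 1, by omega⟩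
  simp only [Nat.add_sub_cancel]
  -- re-index `j = i + 1`, `i < k + 1`
  rw [← Finset.Ico_add_one_right_eq_Icc, Finset.sum_Ico_eq_sum_range,
    show k + 1 + 1 - 1 = k + 1 by omega]
  simp only [Nat.add_sub_cancel_left]
  have hS := summable_vonMangoldt_mul_log_pow_div_real hA
  -- expand `L¹_k` and exchange the sums on the right
  simp_rw [eval_laguerre_one]
  have hswap : ∑' m : ℕ, (Λ m : ℝ) / (m : ℝ) ^ A *
      ∑ i ∈ Finset.range (k + 1), (-1) ^ i * ((k + 1).choose (i + 1) : ℝ) / (i ! : ℝ) *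
        ((2 * A - 1) * Real.log m) ^ i =
      ∑ i ∈ Finset.range (k + 1), ∑' m : ℕ, (Λ m : ℝ) / (m : ℝ) ^ A *
        ((-1) ^ i * ((k + 1).choose (i + 1) : ℝ) / (i ! : ℝ) * ((2 * A - 1) * Real.log m) ^ i) := by
    simp_rw [Finset.mul_sum]
    refine Summable.tsum_finsetSum fun i _ ↦ ?_
    have := (hS i).mul_left ((-1) ^ i * ((k + 1).choose (i + 1) : ℝ) / (i ! : ℝ) * (2 * A - 1) ^ i)
    refine this.congr fun m ↦ ?_
    rw [mul_pow]
    ring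
  rw [hswap, Finset.mul_sum]
  refine Finset.sum_congr rfl fun i _ ↦ ?_
  rw [show 1 + i = i + 1 by omega, ← tsum_mul_left, ← tsum_mul_left]
  refine tsum_congr fun m ↦ ?_
  rw [mul_pow]
  ring

end Sekatskii2015Laguerre

/-- **The arithmetic formula for `k_{n,A}` in Laguerre dress** (the paper's (7) with (10) inserted;
= the tree's `Sekatskii2014_thm7_holds` rewritten by `primePart_eq_laguerre`): for real `A > 1` and
`n ≥ 1`,
`k_{n,A} = 2 − (−1+1/A)ⁿ − (−1−1/(A−1))ⁿ − (2A−1) Σ_m Λ(m) m^{−A} L¹_{n−1}((2A−1) ln m)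
          + (n/2)(2A−1)(ψ(A/2) − ln π) + Σ_{j=2}^{n} C(n,j)(−1)^j 2^{−j}(2A−1)^j ζ(j, A/2)`.
RH-FREE identity (for `A = 1` formally Bombieri–Lagarias/Coffey's `λ_n = … − Σ (Λ(m)/m) L¹_{n−1}(ln m) + …`,
where however the closed term and the prime sum diverge separately).
[cite: Sekatskii2015FirstApplications, eqs. (7), (10) (pp. 7, 9); Sekatskii2014, Thm 7 eq. (10)] -/
theorem liSekatskiiSum_eq_laguerre {A : ℝ} (hA : 1 < A) {n : ℕ} (hn : 1 ≤ n) :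
    liSekatskiiSum A n =
      2 - (-1 + 1 / A) ^ n - (-1 - 1 / (A - 1)) ^ n
        - (2 * A - 1) * ∑' m : ℕ, (Λ m : ℝ) / (m : ℝ) ^ A *
            (laguerre 1 (n - 1)).eval ((2 * A - 1) * Real.log m)
        + (n : ℝ) / 2 * (2 * A - 1) * ((Complex.digamma ((A / 2 : ℝ) : ℂ)).re - Real.log Real.pi)
        + ∑ j ∈ Finset.Icc 2 n, (n.choose j : ℝ) * (-1) ^ j * (2 * A - 1) ^ j / 2 ^ j *
            ∑' m : ℕ, 1 / ((m : ℝ) + A / 2) ^ j := by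
  rw [Sekatskii2014_thm7_holds A hA n hn, liSekatskiiArith,
    Sekatskii2015Laguerre.primePart_eq_laguerre hA hn]
  ring

end Literature.NumberTheory.LFunctions
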